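import Mathlib
import Literature.NumberTheory.Automorphic.AutomorphicRepsGLSatakeFlathProofs
import Literature.NumberTheory.Automorphic.AutomorphicFormsGLTranslates
import Literature.NumberTheory.Automorphic.AutomorphicFormsTranslates
import Literature.NumberTheory.Automorphic.AutomorphicFormsSpan
import HarnessLib

/-!
# Hecke operators preserve the Harish-Chandra spaces

Stub `stub_C1` of the line `BaireSketch` of the crux `HeckeEigenvalueField`
(stmt-Langlands-13632), topic `NumberTheory/Automorphic`.

For `𝔫 ≠ 0`, a finite place `v ∤ 𝔫`, `ϖ ∈ K_vˣ` and `i`, the double-coset operator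
`T = [K(𝔫) t_{v,i}(ϖ) K(𝔫)]` (`heckeOperator` of the right translation representation of
`GL_n(𝔸_K)` at the principal congruence level `K(𝔫) = principalCongruenceLevel n K 𝔫`) maps
the spanning set of Harish-Chandra's finiteness theorem (`harishChandra_finiteness`) into
itself: the automorphic forms `φ` of level `K(𝔫)` killed by an ideal `J ≤ Z(𝔤)` (through
central words) all of whose `K_∞`-slices `k ↦ φ (g k)` lie in a fixed space `M` of functions
on `K_∞`.

Proof (Borel–Jacquet 1979, §4.3 and §4.6; Bump, *Automorphic forms and representations*,
§3.3): the `K(𝔫)`-orbit of the coset `t K(𝔫)` is finite — it is the image of the finite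
`GL_n(𝒪_v)`-orbit of `t GL_n(𝒪_v)` (`GL_n(𝒪_v) ↪ K(𝔫)` at `v ∤ 𝔫`,
`isMaximalAt_principalCongruenceLevel`, `finite_orbit_valuedCongruenceSubgroup_one`) — so on
the `K(𝔫)`-invariant `φ` the operator is a finite sum `∑ⱼ r(yⱼ) φ` of right translates by
finite adeles `yⱼ ∈ K(𝔫) t K(𝔫)`, and `T φ` is again `K(𝔫)`-invariant
(`heckeOperator_apply_mem_fixedPoints`). Each `r(y) φ` is automorphic
(`IsAutomorphicForm.rightTranslation_gl`), killed by `J` (central words commute with right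
translations centralising `GL_n(K_∞)`, `applyFree_comp_mul_right`) and has its `K_∞`-slices
in `M` (the slice of `r(y) φ` at `g` is the slice of `φ` at `g y`), and these three conditions
are stable under sums (`IsAutomorphicForm.add_of_top`, `applyFree_add_right_of_top`).

## References

* A. Borel, H. Jacquet, *Automorphic forms and automorphic representations*, Proc. Sympos.
  Pure Math. 33 (Corvallis 1977), Part 1 (1979), §4.3, §4.6 [BorelJacquetCorvallis1979].
* D. Bump, *Automorphic forms and representations* (1997), §3.3.
-/

set_option linter.dupNamespace false

noncomputable section

open scoped Classical
open Literature.NumberTheory.Automorphic NumberField NumberField.mixedEmbedding IsDedekindDomain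

namespace Summit.Langlands.Langlands.Theorems.HeckeEigenvalueField.Baire

variable {n : ℕ} {K : Type} [Field K] [NumberField K]

/-- **The `K(𝔫)`-double cosets of local elements are finite.** For `𝔫 ≠ 0`, `v ∤ 𝔫` and
`t₀ ∈ GL_n(K_v)`, the `K(𝔫)`-orbit of the coset `ι_v(t₀) K(𝔫)` in `GL_n(𝔸_K) ⧸ K(𝔫)` is
finite: it is the image of the `GL_n(𝒪_v)`-orbit of `ι_v(t₀) GL_n(𝒪_v)` (finite, `GL_n(𝒪_v)`
being compact open in `GL_n(K_v)`, `finite_orbit_valuedCongruenceSubgroup_one`) under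
`GL_n(𝔸_K) ⧸ ι_v(GL_n(𝒪_v)) → GL_n(𝔸_K) ⧸ K(𝔫)` (`ι_v(GL_n(𝒪_v)) ≤ K(𝔫)` for `v ∤ 𝔫`,
`isMaximalAt_principalCongruenceLevel`), because `x ι_v(t₀) K(𝔫) = ι_v(x_v) ι_v(t₀) K(𝔫)` for
`x ∈ K(𝔫)`: the element `ι_v(x_v)⁻¹ x ∈ K(𝔫)` has trivial `v`-component and commutes with
`ι_v(t₀)`. (Everything is typed on `G = GL_n(𝔸_K)` as `(AdelicGroupData.gl n K).Adelic`, the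
group of the right translation representation.) Bump, *Automorphic forms and representations*,
§3.3; Borel–Jacquet 1979, §4.6. [folklore] -/
theorem finite_orbit_principalCongruenceLevel_ofLocal {𝔫 : Ideal (𝓞 K)} (h𝔫 : 𝔫 ≠ 0)
    {v : HeightOneSpectrum (𝓞 K)} (hv : ¬ v.asIdeal ∣ 𝔫)
    (t₀ : GL (Fin n) (v.adicCompletion K)) :
    (MulAction.orbit (principalCongruenceLevel n K 𝔫)
      ((GLn.ofLocal n K v t₀ : (AdelicGroupData.gl n K).Adelic) :
        (AdelicGroupData.gl n K).Adelic ⧸ principalCongruenceLevel n K 𝔫)).Finite := by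
  let ι : GL (Fin n) (v.adicCompletion K) →* (AdelicGroupData.gl n K).Adelic := GLn.ofLocal n K v
  let K₀ : Subgroup (GL (Fin n) (v.adicCompletion K)) :=
    valuedCongruenceSubgroup (Fin n) (1 : WithZero (Multiplicative ℤ))
  let U : Subgroup (AdelicGroupData.gl n K).Adelic := principalCongruenceLevel n K 𝔫
  have hle : K₀.map ι ≤ U := isMaximalAt_principalCongruenceLevel n K v h𝔫 hv
  have hπι : ∀ g : GL (Fin n) (v.adicCompletion K),
      (AdelicGroupData.gl n K).toLocal v (ι g) = g :=
    fun g => GLn.toLocal_ofLocal g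
  have hfin₁ : (MulAction.orbit (K₀.map ι) ((ι t₀ : (AdelicGroupData.gl n K).Adelic) :
      (AdelicGroupData.gl n K).Adelic ⧸ K₀.map ι)).Finite :=
    finite_orbit_map ι GLn.ofLocal_injective K₀ t₀
      (finite_orbit_valuedCongruenceSubgroup_one n K v t₀)
  change (MulAction.orbit U ((ι t₀ : (AdelicGroupData.gl n K).Adelic) :
    (AdelicGroupData.gl n K).Adelic ⧸ U)).Finite
  refine (hfin₁.image (Subgroup.quotientMapOfLE hle)).subset ?_
  rintro _ ⟨x, rfl⟩
  -- the `v`-component `x_v` of `x ∈ K(𝔫) ≤ K^max` lies in `GL_n(𝒪_v)`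
  set xv : (AdelicGroupData.gl n K).Adelic :=
    ι ((AdelicGroupData.gl n K).toLocal v (x : (AdelicGroupData.gl n K).Adelic)) with hxv_def
  have hxv : xv ∈ K₀.map ι :=
    ⟨_, toLocal_mem_valuedCongruenceSubgroup_one (principalCongruenceLevel_le n K 𝔫 x.2) v, rfl⟩
  refine ⟨((xv * ι t₀ : (AdelicGroupData.gl n K).Adelic) :
    (AdelicGroupData.gl n K).Adelic ⧸ K₀.map ι), ⟨⟨xv, hxv⟩, rfl⟩, ?_⟩
  change ((xv * ι t₀ : (AdelicGroupData.gl n K).Adelic) : (AdelicGroupData.gl n K).Adelic ⧸ U) =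
    (((x : (AdelicGroupData.gl n K).Adelic) * ι t₀ : (AdelicGroupData.gl n K).Adelic) :
      (AdelicGroupData.gl n K).Adelic ⧸ U)
  rw [QuotientGroup.eq]
  -- `x_v⁻¹ x` has trivial `v`-component, hence commutes with `ι t₀`
  have hc1 : (AdelicGroupData.gl n K).toLocal v
      (xv⁻¹ * (x : (AdelicGroupData.gl n K).Adelic)) = 1 := by
    rw [map_mul, map_inv, hxv_def, hπι, inv_mul_cancel]
  have hcomm : ι t₀ * (xv⁻¹ * (x : (AdelicGroupData.gl n K).Adelic)) =
      xv⁻¹ * (x : (AdelicGroupData.gl n K).Adelic) * ι t₀ :=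
    GLn.ofLocal_mul_eq_mul_ofLocal_of_toLocal_eq_one t₀ hc1
  have key : (xv * ι t₀)⁻¹ * ((x : (AdelicGroupData.gl n K).Adelic) * ι t₀) =
      xv⁻¹ * (x : (AdelicGroupData.gl n K).Adelic) := by
    rw [mul_inv_rev, mul_assoc, ← mul_assoc xv⁻¹, ← hcomm, inv_mul_cancel_left]
  rw [key]
  exact mul_mem (inv_mem (hle hxv)) x.2

/-- **(C1) Hecke operators preserve the Harish-Chandra spaces.** For `𝔫 ≠ 0`, `v ∤ 𝔫`,
`ϖ ∈ K_vˣ` and `i`, the double-coset operator `T_{v,i}(ϖ) = [K(𝔫) t_{v,i}(ϖ) K(𝔫)]` maps the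
set of automorphic forms on `GL_n(𝔸_K)` of level `K(𝔫)`, killed by the ideal `J ≤ Z(𝔤)`
(through central words) and with all `K_∞`-slices in the space `M`, into itself: on a
`K(𝔫)`-invariant `φ` it is a finite sum of right translates `r(y) φ` by finite adeles
`y ∈ K(𝔫) t K(𝔫)` (`finite_orbit_principalCongruenceLevel_ofLocal`), each of which is
automorphic (`IsAutomorphicForm.rightTranslation_gl`), killed by `J`
(`applyFree_comp_mul_right`: `y` centralises `GL_n(K_∞)`) and has its slices in `M` (the
slice of `r(y) φ` at `g` is that of `φ` at `g y`); these conditions are additive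
(`IsAutomorphicForm.add_of_top`, `applyFree_add_right_of_top`), and `T φ` is `K(𝔫)`-invariant
(`heckeOperator_apply_mem_fixedPoints`). (The right-stability hypothesis `hM` on `M`, part of
the registered signature, is not needed.) Borel–Jacquet 1979, §4.3 and §4.6; Bump,
*Automorphic forms and representations*, §3.3. [folklore] -/
theorem stub_C1 (hcpt : isCompact_glFiniteIntegralLevel n K) {𝔫 : Ideal (𝓞 K)} (h𝔫 : 𝔫 ≠ 0)
    (J : Ideal (centerU (archGroupGL n K))) (M : Submodule ℂ (Kinf n K → ℂ))
    (hM : ∀ (k₀ : Kinf n K), ∀ f ∈ M, (fun k => f (k * k₀)) ∈ M)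
    {v : HeightOneSpectrum (𝓞 K)} (hv : ¬ v.asIdeal ∣ 𝔫) (ϖ : (v.adicCompletion K)ˣ) (i : ℕ)
    {φ : (AdelicGroupData.gl n K).Adelic → ℂ}
    (hφ : φ ∈ {φ : (AdelicGroupData.gl n K).Adelic → ℂ |
      IsAutomorphicForm (AutomorphyDatum.gl n K hcpt) φ ∧
      IsRightInvariantUnder (principalCongruenceLevel n K 𝔫) φ ∧
      (∀ (p : FreeAlgebra ℝ (archGroupGL n K).lie) (hp : IsCentralWord p),
        (⟨freeToEnveloping (archGroupGL n K) p, hp⟩ : centerU (archGroupGL n K)) ∈ J →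
          applyFree (AutomorphyDatum.gl n K hcpt).ofArch p φ = 0) ∧
      ∀ g : (AdelicGroupData.gl n K).Adelic,
        (fun k : Kinf n K => φ (g * (AutomorphyDatum.gl n K hcpt).ofK k)) ∈ M}) :
    heckeOperator (rightTranslation (AdelicGroupData.gl n K)) (principalCongruenceLevel n K 𝔫)
        (heckeDiagAt n K v ϖ i) φ ∈ {φ : (AdelicGroupData.gl n K).Adelic → ℂ |
      IsAutomorphicForm (AutomorphyDatum.gl n K hcpt) φ ∧
      IsRightInvariantUnder (principalCongruenceLevel n K 𝔫) φ ∧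
      (∀ (p : FreeAlgebra ℝ (archGroupGL n K).lie) (hp : IsCentralWord p),
        (⟨freeToEnveloping (archGroupGL n K) p, hp⟩ : centerU (archGroupGL n K)) ∈ J →
          applyFree (AutomorphyDatum.gl n K hcpt).ofArch p φ = 0) ∧
      ∀ g : (AdelicGroupData.gl n K).Adelic,
        (fun k : Kinf n K => φ (g * (AutomorphyDatum.gl n K hcpt).ofK k)) ∈ M} := by
  -- the right-stability `hM` of `M` belongs to the registered signature but is not used below
  have _ := hM
  obtain ⟨hφA, hφU, hφJ, hφM⟩ := hφ
  let 𝒟 := AutomorphyDatum.gl n K hcpt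
  let ρ : Representation ℂ (AdelicGroupData.gl n K).Adelic ((AdelicGroupData.gl n K).Adelic → ℂ) :=
    rightTranslation (AdelicGroupData.gl n K)
  let U : Subgroup (AdelicGroupData.gl n K).Adelic := principalCongruenceLevel n K 𝔫
  let t₀ : GL (Fin n) (v.adicCompletion K) := heckeDiag n ϖ i
  let t : (AdelicGroupData.gl n K).Adelic := GLn.ofLocal n K v t₀
  have ht : (heckeDiagAt n K v ϖ i : (AdelicGroupData.gl n K).Adelic) = t :=
    heckeDiagAt_eq_ofLocal n K v ϖ i
  rw [ht]
  change heckeOperator ρ U t φ ∈ _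
  -- (1) the double coset `K(𝔫) t K(𝔫)` is a finite union of left cosets
  have hfin : (MulAction.orbit U (t : (AdelicGroupData.gl n K).Adelic ⧸ U)).Finite :=
    finite_orbit_principalCongruenceLevel_ofLocal h𝔫 hv t₀
  -- (2) `K(𝔫)` and `t` are finite-adelic
  have hUf : U ≤ 𝒟.finiteAdelic :=
    (principalCongruenceLevel_le n K 𝔫).trans
      (𝒟.le_finiteAdelic _ (glIntegralLevel_mem_finiteLevelsGL n K hcpt))
  have htf : t ∈ 𝒟.finiteAdelic := GLn.ofLocal_mem_range_ofFinite v t₀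
  -- (3) automorphy, annihilation by `J` and slices in `M` are stable under `0`, `+` and the
  -- right translations `r(y)`, `y` finite-adelic
  let P : ((AdelicGroupData.gl n K).Adelic → ℂ) → Prop := fun ψ =>
    IsAutomorphicForm 𝒟 ψ ∧
      (∀ (p : FreeAlgebra ℝ (archGroupGL n K).lie) (hp : IsCentralWord p),
        (⟨freeToEnveloping (archGroupGL n K) p, hp⟩ : centerU (archGroupGL n K)) ∈ J →
          applyFree 𝒟.ofArch p ψ = 0) ∧
      ∀ g : (AdelicGroupData.gl n K).Adelic, (fun k : Kinf n K => ψ (g * 𝒟.ofK k)) ∈ M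
  have hH : 𝒟.arch.lie = ⊤ := archGroupGL_lie n K
  have hc : 𝒟.arch.carrier = ⊤ := archGroupGL_carrier n K
  have hP0 : P 0 :=
    ⟨isAutomorphicForm_zero 𝒟, fun p _ _ => applyFree_zero_right 𝒟.ofArch p,
      fun _ => M.zero_mem⟩
  have hPadd : ∀ a b, P a → P b → P (a + b) := by
    rintro a b ⟨haA, haJ, haM⟩ ⟨hbA, hbJ, hbM⟩
    refine ⟨haA.add_of_top hH hc (directedOn_finiteLevels_gl hcpt) hbA, fun p hp hpJ => ?_,
      fun g => M.add_mem (haM g) (hbM g)⟩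
    rw [applyFree_add_right_of_top 𝒟.ofArch hH hc p haA.archSmooth hbA.archSmooth,
      haJ p hp hpJ, hbJ p hp hpJ, add_zero]
  have hPr : ∀ y ∈ 𝒟.finiteAdelic, ∀ ψ, P ψ → P (ρ y ψ) := by
    rintro y hy ψ ⟨hψA, hψJ, hψM⟩
    have hcomm : ∀ h : 𝒟.arch.carrier, 𝒟.ofArch h * y = y * 𝒟.ofArch h :=
      fun h => 𝒟.commute_ofArch h y hy
    refine ⟨hψA.rightTranslation_gl hy, fun p hp hpJ => ?_, fun g => ?_⟩
    · change applyFree 𝒟.ofArch p (fun g => ψ (g * y)) = 0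
      rw [applyFree_comp_mul_right 𝒟.ofArch p ψ hcomm, hψJ p hp hpJ]
      rfl
    · have hslice : (fun k : Kinf n K => ρ y ψ (g * 𝒟.ofK k)) =
          fun k => ψ (g * y * 𝒟.ofK k) := by
        funext k
        change ψ (g * 𝒟.ofK k * y) = _
        rw [mul_assoc, AutomorphyDatum.ofK_apply, hcomm, ← mul_assoc]
      rw [hslice]
      exact hψM (g * y)
  -- (4) `T φ = ∑ⱼ r(yⱼ) φ` with `yⱼ ∈ K(𝔫) t K(𝔫)` finite-adelic
  have hsum : heckeOperator ρ U t φ = ∑ y ∈ hfin.toFinset, ρ y.out φ := by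
    rw [heckeOperator, finsum_mem_eq_finite_toFinset_sum _ hfin, LinearMap.sum_apply]
  have hout : ∀ y ∈ hfin.toFinset,
      (y.out : (AdelicGroupData.gl n K).Adelic) ∈ 𝒟.finiteAdelic := by
    intro y hy
    rw [Set.Finite.mem_toFinset] at hy
    obtain ⟨k, hk, k', hk', hyo⟩ := exists_out_eq_mul_mul hy
    rw [hyo]
    exact mul_mem (mul_mem (hUf hk) htf) (hUf hk')
  have hPT : P (heckeOperator ρ U t φ) := by
    rw [hsum]
    exact Finset.sum_induction _ P hPadd hP0 fun y hy => hPr _ (hout y hy) φ ⟨hφA, hφJ, hφM⟩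
  -- (5) `T φ` is `K(𝔫)`-invariant
  have hφU' : φ ∈ ρ.fixedPoints U := (isRightInvariantUnder_iff_mem_fixedPoints _ _ _).1 hφU
  have hTU : IsRightInvariantUnder U (heckeOperator ρ U t φ) :=
    (isRightInvariantUnder_iff_mem_fixedPoints _ _ _).2
      (heckeOperator_apply_mem_fixedPoints ρ U t hφU' hfin)
  exact ⟨hPT.1, hTU, hPT.2.1, hPT.2.2⟩

end Summit.Langlands.Langlands.Theorems.HeckeEigenvalueField.Baire

end
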